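import Summits.QuantumFields.BalabanUV.T4Continuum.Support.NE9ScalingDictionary
import Summits.QuantumFields.BalabanUV.T4Continuum.Support.NE9BirthInsertionUnbounded

/-!
# NE9ScalingDictionaryUnbounded — the c4 junction (scaled ↔ unscaled one-block dictionary) WITHOUT the bounded-action
binder: referee DV-3 followed through `NE9ScalingDictionary` §5 (unit `b2b-balaban-t4-ne9-formalise-leaf-03`, GEN 2;
NE9 formalisation swarm of `t4/T4-NE9-TRIGGER.json`; journal INTENT 2026-08-20 l.6457; cell `pub-balaban`, node U3 / row NE9,
rung (B)+1 on a finite T⁴)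

HONEST FRAMING (T4-DAG PAGE 1).  Rung (B)+1 on a FIXED finite torus; NOT infinite volume, NOT the mass gap, NOT Clay.  NE9
is NOT PRINTED and is NOT PROVED here (spine 0/9 unchanged; 0/15 skeleton leaves instantiated on Bałaban's objects).  This
module is OUR OWN WORK (Summits side) on the abstract one-block MODEL objects already in the tree; it asserts NOTHING about
Bałaban's functionals and quotes nothing printed as a hypothesis (ABSOLUTE RULE; every declaration is [folklore]).

WHY.  The swarm referee's divergence note DV-3 (`t4/formal/NE9/REFEREE.md` pass 1 §3) observed that road P3's insertion
supplier (iv) carried a bounded-action binder `hS₀ : |S| ≤ S₀` — a MODEL restriction (a quadratic fluctuation action is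
unbounded on the full field space).  GEN 0 of this unit removed it at the supplier (`NE9BirthInsertionUnbounded`, p208362:
`hasDerivAt_actR_of_nonneg`, `couplingTwoPoint_of_insertion_of_nonneg`, `hCup_of_insertion_of_nonneg`, for `S ≥ 0`
UNBOUNDED, from `Integrable f` alone).  The c4 JUNCTION `NE9ScalingDictionary` §5 (leaf-04, p208322), written against P3's
original faces, still carries the binder in its three theorems: `hasDerivAt_actR_inv_sq (hS₀ : ∀ x, |S x| ≤ S₀)`,
`actR_inv_sq_couplingTwoPoint (hS₀ …)`, `formAct_couplingTwoPoint_of_insertion (hS₀0 : 0 ≤ S₀) (hbd : ∀ x ∈ K, |quadForm A x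
+ P x| ≤ S₀)`.  This module re-derives the three with those binders DELETED and every other binder and every conclusion
UNCHANGED (token for token), by routing the same two-line proofs through GEN 0's `_of_nonneg` faces.  What remains on the
action at the junction is ONE sign condition ON THE BLOCK, `hpos : ∀ x ∈ K, 0 ≤ quadForm A x + P x` (met when the
non-quadratic rest is dominated by the free action on the block, §4) — the boundedness of the block `K` is no longer used
anywhere on the (L)-supplier side (ii)/(iv) of row NE9.

WHAT IS PROVED (letters of `NE9ScalingDictionary`: `quadForm`, `gaussRef`, `scaledCut`, `scaledExp`, `formAct`; of
`T4ComplexDilation`: `blockInt`, `absAct`; of `NE9BirthCouplingTwoPoint`: `actR`, `realNorm`, `birthConst = K(θ,n)`;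
of `NE9BirthInsertion`: `insertion`).
* §1 `hasDerivAt_actR_inv_sq_of_nonneg` — chain rule `∂_s = −2s⁻³·∂_t` for `σ ↦ actR(σ⁻²)`, `S ≥ 0` measurable, NO `S₀`.
* §2 `actR_inv_sq_couplingTwoPoint_of_nonneg` — t-currency transfer of the insertion two-point clause to `s, s′ ∈ ]0, γ]`,
  NO `S₀`.
* §3 **`formAct_couplingTwoPoint_of_insertion_of_nonneg`** — THE JUNCTION: from supplier (iv)'s printed-TYPE hypothesis
  alone (uniform `absAct ≤ N` on the dilated real range `r ≥ (1−θ)γ⁻²`; cut-off `K` measurable, density `1_K·e^{Φ}`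
  integrable, rest `P` measurable, action NON-NEGATIVE ON THE BLOCK) the scaled cut-off form obeys
  `‖formAct s‖ ≤ N ∧ ‖formAct s − formAct s′‖ ≤ (K(θ,n)/γ⁻²)·N·|s⁻² − s′⁻²|` for all `s, s′ ∈ ]0, γ]` — the conclusion of
  `NE9ScalingDictionary.formAct_couplingTwoPoint_of_insertion` VERBATIM, binders `hS₀0`, `hbd` GONE.
* §4 how `hpos` is met: `nonneg_on_of_dominated` (`|P| ≤ quadForm A` on `K`); the box witness of
  `NE9ScalingDictionaryWitness` re-derived through §3 (`box_formAct_couplingTwoPoint_of_nonneg`, one hypothesis fewer).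
* §5 NEW GROUND (non-vacuity where the old junction is void): the UNCUT free block `K = univ` with the coupling-free Gaussian
  density `e^{−quadForm A}` and purely quadratic action meets every hypothesis of §3 with `N = 1`
  (`uncut_formAct_couplingTwoPoint`), while the deleted binder is unsatisfiable there (`not_bounded_quadForm`: `quadForm A` is
  unbounded on `univ` for `A ≻ 0`, `ι` non-empty).
NOT HERE: anything localized; Bałaban's objects (skeleton O-NE9-1); the sign condition itself for Bałaban's expanded action
(a displayed binder for the O-NE9-1 instantiator — cell XREAD l.6338 I1).  Kernel inputs BY NAME: `NE9ScalingDictionary`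
(p208322) and `NE9BirthInsertionUnbounded` (p208362) imported; `NE9ScalingDictionaryWitness` (p208635) is NOT imported and
nothing of it is restated (§4 takes the box block as `Set.Icc (−1) 1` inline and bounds `absAct` by the density's modulus,
`absAct_le_of_norm_le`, a different lemma); Mathlib `HasDerivAt.scomp`, `integral_mono_of_nonneg`,
`Integrable.of_integral_ne_zero`.  Modifies nothing; no END face re-wired; 0 `def`.
-/

noncomputable section

namespace Summit.QuantumFields.BalabanUV.T4Continuum.NE9ScalingDictionaryUnbounded

open MeasureTheory Complex Set Matrix
open scoped NNReal ENNReal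
open Literature.MathematicalPhysics.QuantumFieldTheory.Balaban1983to89.T4ComplexDilation
open Summit.QuantumFields.BalabanUV.T4Continuum.NE9BirthInsertion (insertion)
open Summit.QuantumFields.BalabanUV.T4Continuum.NE9BirthCouplingTwoPoint
open Summit.QuantumFields.BalabanUV.T4Continuum.NE9BirthInsertionUnbounded
open Summit.QuantumFields.BalabanUV.T4Continuum.NE9CouplingTwoPoint (formAct)
open Summit.QuantumFields.BalabanUV.T4Continuum.NE9ScalingDictionary

variable {ι : Type*} [Fintype ι] [DecidableEq ι]

/-! ## §1 Chain rule without the bounded-action binder -/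

/-- **CHAIN RULE `∂_s = −2s⁻³·∂_t`, unbounded non-negative action** — `NE9ScalingDictionary.hasDerivAt_actR_inv_sq` with
`hS₀ : ∀ x, |S x| ≤ S₀` replaced by `hS0 : ∀ x, 0 ≤ S x`; same derivative value (normalisation term + INSERTION at
`t = s⁻²`, one Jacobian `−2s⁻³`), supplied by GEN 0's `hasDerivAt_actR_of_nonneg`. [folklore] -/
theorem hasDerivAt_actR_inv_sq_of_nonneg (A : Matrix ι ι ℝ) (hA : A.PosDef) {X : Type*} [MeasurableSpace X]
    {μ : Measure X} {f : X → ℂ} (hf : Integrable f μ) {S : X → ℝ} (hS : Measurable S) (hS0 : ∀ x, 0 ≤ S x)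
    {s : ℝ} (hs : 0 < s) :
    HasDerivAt (fun σ : ℝ => actR A μ f S ((σ⁻¹) ^ 2))
      ((-(2 * (s⁻¹) ^ 3)) •
        ((((Fintype.card ι : ℝ) / (2 * (s⁻¹) ^ 2) * realNorm A ((s⁻¹) ^ 2) : ℝ) : ℂ) *
            blockInt μ f S ((((s⁻¹) ^ 2 : ℝ)) : ℂ) +
          (realNorm A ((s⁻¹) ^ 2) : ℂ) * insertion μ f S ((s⁻¹) ^ 2))) s := by
  have ht : 0 < (s⁻¹) ^ 2 := by positivity
  exact (hasDerivAt_actR_of_nonneg A hA hf hS hS0 ht).scomp s (hasDerivAt_inv_sq hs.ne')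

/-! ## §2 t-currency transfer without the bounded-action binder -/

/-- **t-CURRENCY TRANSFER, unbounded non-negative action** — `NE9ScalingDictionary.actR_inv_sq_couplingTwoPoint` with the
binder `hS₀` DELETED: under the uniform bound `absAct ≤ N` on `r ≥ (1−θ)γ⁻²`, for `s, s′ ∈ ]0, γ]` the scaled activity
`G σ = actR(σ⁻²)` satisfies `‖G s‖ ≤ N ∧ ‖G s − G s′‖ ≤ (K(θ,n)/γ⁻²)·N·|s⁻² − s′⁻²|` (moduli per unit of `t = g⁻²`,
trigger c5). [folklore] -/
theorem actR_inv_sq_couplingTwoPoint_of_nonneg (A : Matrix ι ι ℝ) (hA : A.PosDef) {X : Type*} [MeasurableSpace X]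
    {μ : Measure X} {f : X → ℂ} (hf : Integrable f μ) {S : X → ℝ} (hSm : Measurable S) (hS : ∀ x, 0 ≤ S x)
    {θ : ℝ} (hθ : 0 < θ) (hθ1 : θ < 1) {γ : ℝ} (hγ : 0 < γ) {N : ℝ}
    (habs : ∀ r, (1 - θ) * (γ⁻¹) ^ 2 ≤ r → absAct A μ f S r ≤ N) {s s' : ℝ} (hs : s ∈ Ioc 0 γ)
    (hs' : s' ∈ Ioc 0 γ) :
    ‖actR A μ f S ((s⁻¹) ^ 2)‖ ≤ N ∧
      ‖actR A μ f S ((s⁻¹) ^ 2) - actR A μ f S ((s'⁻¹) ^ 2)‖ ≤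
        birthConst θ (Fintype.card ι) / (γ⁻¹) ^ 2 * N * |(s⁻¹) ^ 2 - (s'⁻¹) ^ 2| :=
  couplingTwoPoint_of_insertion_of_nonneg A hA hf hSm hS hθ hθ1 (by positivity : (0 : ℝ) < (γ⁻¹) ^ 2) habs
    (inv_sq_ge_of_mem_Ioc hs) (inv_sq_ge_of_mem_Ioc hs')

/-! ## §3 The junction without the bounded-action binder -/

/-- **THE JUNCTION (trigger c4, one-block model level), unbounded non-negative action.**  The statement of
`NE9ScalingDictionary.formAct_couplingTwoPoint_of_insertion` with the binders `(hS₀0 : 0 ≤ S₀)` and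
`(hbd : ∀ x ∈ K, |quadForm A x + P x| ≤ S₀)` DELETED and everything else unchanged: from supplier (iv)'s printed-TYPE
hypothesis ALONE — the uniform bound `absAct ≤ N` on the dilated real range `r ≥ (1−θ)γ⁻²` for the UNSCALED block
(Lebesgue reference measure, coupling-free measurable cut-off `K` and integrable density `1_K·e^{Φ}`, measurable rest `P`,
action `quadForm A + P` NON-NEGATIVE ON THE BLOCK) — the SCALED cut-off form (`formAct` with the `s`-free Gaussian
`gaussRef A`, the MOVING cut-off `K_s = (s•·)⁻¹K`, prefactor `1`, dilated exponent) satisfies, for all `s, s′ ∈ ]0, γ]`,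
`‖formAct s‖ ≤ N ∧ ‖formAct s − formAct s′‖ ≤ (K(θ,n)/γ⁻²)·N·|s⁻² − s′⁻²|`.  Proof: clip the action to the block
(`actR`/`absAct` unchanged, NE9ScalingDictionary §4), apply §2 to the clipped non-negative measurable action, and read both
activities through the dictionary `actR_eq_formAct`. [folklore] -/
theorem formAct_couplingTwoPoint_of_insertion_of_nonneg (A : Matrix ι ι ℝ) (hA : A.PosDef) {K : Set (ι → ℝ)}
    (hK : MeasurableSet K) {Φ : (ι → ℝ) → ℂ} (hint : Integrable (K.indicator fun x => cexp (Φ x)) volume)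
    {P : (ι → ℝ) → ℝ} (hP : Measurable P) (hpos : ∀ x ∈ K, 0 ≤ quadForm A x + P x)
    {θ : ℝ} (hθ : 0 < θ) (hθ1 : θ < 1) {γ : ℝ} (hγ : 0 < γ) {N : ℝ}
    (habs : ∀ r, (1 - θ) * (γ⁻¹) ^ 2 ≤ r →
      absAct A volume (K.indicator fun x => cexp (Φ x)) (fun x => quadForm A x + P x) r ≤ N)
    {s s' : ℝ} (hs : s ∈ Ioc 0 γ) (hs' : s' ∈ Ioc 0 γ) :
    ‖formAct (gaussRef A) (scaledCut K) (fun _ => 1) (scaledExp Φ P) s‖ ≤ N ∧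
      ‖formAct (gaussRef A) (scaledCut K) (fun _ => 1) (scaledExp Φ P) s -
          formAct (gaussRef A) (scaledCut K) (fun _ => 1) (scaledExp Φ P) s'‖ ≤
        birthConst θ (Fintype.card ι) / (γ⁻¹) ^ 2 * N * |(s⁻¹) ^ 2 - (s'⁻¹) ^ 2| := by
  -- clip the action to the block: non-negative and measurable (boundedness is no longer asked); `actR`/`absAct` unchanged
  have hSm : Measurable fun x => quadForm A x + P x := (measurable_quadForm A).add hP
  have hSKm : Measurable (K.indicator fun x => quadForm A x + P x) := hSm.indicator hK
  have hSK0 : ∀ x, 0 ≤ K.indicator (fun x => quadForm A x + P x) x :=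
    indicator_nonneg_of (S := fun x => quadForm A x + P x) hpos
  have habs' : ∀ r, (1 - θ) * (γ⁻¹) ^ 2 ≤ r →
      absAct A volume (K.indicator fun x => cexp (Φ x)) (K.indicator fun x => quadForm A x + P x) r ≤ N :=
    fun r hr => by rw [absAct_indicator_clip]; exact habs r hr
  have key := actR_inv_sq_couplingTwoPoint_of_nonneg A hA hint hSKm hSK0 hθ hθ1 hγ habs' hs hs'
  rw [actR_indicator_clip, actR_indicator_clip, actR_eq_formAct A hA K Φ P hs.1,
    actR_eq_formAct A hA K Φ P hs'.1] at key
  exact key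

/-! ## §4 How the remaining sign binder is met; the box witness through §3 -/

omit [DecidableEq ι] in
/-- `hpos` from DOMINATION: if the non-quadratic rest is dominated by the free action on the block, `|P x| ≤ quadForm A x`
for `x ∈ K`, the total action is non-negative on the block (the shape in which the O-NE9-1 instantiator will meet §3's
only condition on the action). [folklore] -/
theorem nonneg_on_of_dominated (A : Matrix ι ι ℝ) {K : Set (ι → ℝ)} {P : (ι → ℝ) → ℝ}
    (hdom : ∀ x ∈ K, |P x| ≤ quadForm A x) : ∀ x ∈ K, 0 ≤ quadForm A x + P x := by
  intro x hx
  have h := hdom x hx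
  have h' : -P x ≤ |P x| := neg_le_abs _
  linarith

omit [DecidableEq ι] in
/-- The free action of `A ≻ 0` is non-negative everywhere. [folklore] -/
theorem quadForm_nonneg' (A : Matrix ι ι ℝ) (hA : A.PosDef) (x : ι → ℝ) : 0 ≤ quadForm A x := by
  rw [quadForm]
  have h := hA.posSemidef.dotProduct_mulVec_nonneg x
  rw [star_trivial] at h
  positivity

/-- A uniform bound `‖f‖ ≤ c` on the density gives the printed-TYPE bound of supplier (iv) on the free block for EVERY
density shape (not only cut-off constants): `absAct A volume f (quadForm A + 0) r ≤ c` for `r > 0` — the normalisation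
`‖N_A(r)‖⁻¹` compensates the Gaussian volume. [folklore] -/
theorem absAct_le_of_norm_le (A : Matrix ι ι ℝ) (hA : A.PosDef) {f : (ι → ℝ) → ℂ} {c : ℝ}
    (hf : ∀ x, ‖f x‖ ≤ c) {r : ℝ} (hr : 0 < r) :
    absAct A volume f (fun x => quadForm A x + 0) r ≤ c := by
  have hre : 0 < ((r : ℝ) : ℂ).re := by simpa using hr
  have hN : 0 < ‖gaussNorm A (r : ℂ)‖ := norm_pos_iff.2 (gaussNorm_ne_zero A hA hre)
  -- the real Gaussian weight is integrable: its integral is `‖N_A(r)‖ ≠ 0`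
  have hgauss : ∫ x : ι → ℝ, Real.exp (-(r * quadForm A x)) = ‖gaussNorm A (r : ℂ)‖ := by
    have e : gaussNorm A (r : ℂ) = ((∫ x : ι → ℝ, Real.exp (-(r * quadForm A x)) : ℝ) : ℂ) := by
      unfold gaussNorm
      rw [← integral_complex_ofReal]
      refine integral_congr_ae (Filter.Eventually.of_forall fun x => ?_)
      simp only [quadForm]
      rw [Complex.ofReal_exp]
      congr 1
      push_cast
      ring
    rw [e, Complex.norm_real, Real.norm_of_nonneg (integral_nonneg fun x => (Real.exp_pos _).le)]
  have hint : Integrable (fun x : ι → ℝ => c * Real.exp (-(r * quadForm A x))) volume := by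
    refine Integrable.const_mul ?_ _
    refine Integrable.of_integral_ne_zero ?_
    rw [hgauss]
    exact hN.ne'
  have hmono : ∫ x : ι → ℝ, ‖f x‖ * Real.exp (-(r * (quadForm A x + 0))) ≤
      ∫ x : ι → ℝ, c * Real.exp (-(r * quadForm A x)) :=
    integral_mono_of_nonneg (Filter.Eventually.of_forall fun x => by positivity) hint
      (Filter.Eventually.of_forall fun x => by
        show ‖f x‖ * Real.exp (-(r * (quadForm A x + 0))) ≤ c * Real.exp (-(r * quadForm A x))
        rw [add_zero]
        exact mul_le_mul_of_nonneg_right (hf x) (Real.exp_pos _).le)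
  rw [integral_const_mul, hgauss] at hmono
  unfold absAct
  calc ‖gaussNorm A (r : ℂ)‖⁻¹ * ∫ x : ι → ℝ, ‖f x‖ * Real.exp (-(r * (quadForm A x + 0)))
      ≤ ‖gaussNorm A (r : ℂ)‖⁻¹ * (c * ‖gaussNorm A (r : ℂ)‖) := mul_le_mul_of_nonneg_left hmono (inv_nonneg.2 hN.le)
    _ = c := by field_simp

/-- **THE BOX WITNESS THROUGH §3** (one hypothesis fewer than `NE9ScalingDictionaryWitness.box_formAct_couplingTwoPoint`):
on the free Gaussian block cut off to the box `[−1, 1]^ι` (unit density, purely quadratic action) the junction §3 applies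
with `N = 1` — no bound of the action on the box is computed. [folklore] -/
theorem box_formAct_couplingTwoPoint_of_nonneg (A : Matrix ι ι ℝ) (hA : A.PosDef) {θ : ℝ} (hθ : 0 < θ) (hθ1 : θ < 1)
    {γ : ℝ} (hγ : 0 < γ) {s s' : ℝ} (hs : s ∈ Ioc 0 γ) (hs' : s' ∈ Ioc 0 γ) :
    ‖formAct (gaussRef A) (scaledCut (Set.Icc (fun _ : ι => (-1 : ℝ)) (fun _ => 1))) (fun _ => 1)
        (scaledExp (fun _ : ι → ℝ => (0 : ℂ)) (fun _ => (0 : ℝ))) s‖ ≤ 1 ∧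
      ‖formAct (gaussRef A) (scaledCut (Set.Icc (fun _ : ι => (-1 : ℝ)) (fun _ => 1))) (fun _ => 1)
            (scaledExp (fun _ : ι → ℝ => (0 : ℂ)) (fun _ => (0 : ℝ))) s -
          formAct (gaussRef A) (scaledCut (Set.Icc (fun _ : ι => (-1 : ℝ)) (fun _ => 1))) (fun _ => 1)
            (scaledExp (fun _ : ι → ℝ => (0 : ℂ)) (fun _ => (0 : ℝ))) s'‖ ≤
        birthConst θ (Fintype.card ι) / (γ⁻¹) ^ 2 * 1 * |(s⁻¹) ^ 2 - (s'⁻¹) ^ 2| := by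
  set K : Set (ι → ℝ) := Set.Icc (fun _ : ι => (-1 : ℝ)) (fun _ => 1) with hKdef
  have hK : MeasurableSet K := measurableSet_Icc
  have hvol : volume K ≠ ∞ := by
    rw [hKdef, Real.volume_Icc_pi]
    exact ENNReal.prod_ne_top fun i _ => ENNReal.ofReal_ne_top
  have hint : Integrable (K.indicator fun x => cexp ((fun _ : ι → ℝ => (0 : ℂ)) x)) volume :=
    (integrableOn_const hvol).integrable_indicator hK
  have habs : ∀ r, (1 - θ) * (γ⁻¹) ^ 2 ≤ r →
      absAct A volume (K.indicator fun x => cexp ((fun _ : ι → ℝ => (0 : ℂ)) x))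
        (fun x => quadForm A x + (fun _ : ι → ℝ => (0 : ℝ)) x) r ≤ 1 := by
    intro r hr
    have hr0 : 0 < r := lt_of_lt_of_le (mul_pos (by linarith) (by positivity)) hr
    refine absAct_le_of_norm_le A hA (c := 1) (fun x => ?_) hr0
    refine (norm_indicator_le_norm_self _ _).trans ?_
    simp
  exact formAct_couplingTwoPoint_of_insertion_of_nonneg A hA hK hint (P := fun _ => (0 : ℝ)) measurable_const
    (fun x _ => by rw [add_zero]; exact quadForm_nonneg' A hA x) hθ hθ1 hγ habs hs hs'

/-! ## §5 New ground: the uncut free block (the deleted binder is unsatisfiable, §3 applies) -/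

/-- The coupling-free Gaussian density `e^{−quadForm A}` is Lebesgue-integrable on the whole field space (`A ≻ 0`).
[folklore] -/
theorem integrable_cexp_neg_quadForm (A : Matrix ι ι ℝ) (hA : A.PosDef) :
    Integrable ((Set.univ : Set (ι → ℝ)).indicator fun x => cexp (-(quadForm A x : ℂ))) volume := by
  rw [Set.indicator_univ]
  have hre : 0 < ((1 : ℝ) : ℂ).re := by simp
  have hne : gaussNorm A ((1 : ℝ) : ℂ) ≠ 0 := gaussNorm_ne_zero A hA hre
  have e : gaussNorm A ((1 : ℝ) : ℂ) = ∫ x : ι → ℝ, cexp (-(quadForm A x : ℂ)) := by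
    unfold gaussNorm
    refine integral_congr_ae (Filter.Eventually.of_forall fun x => ?_)
    simp only [quadForm]
    congr 1
    push_cast
    ring
  rw [e] at hne
  exact Integrable.of_integral_ne_zero hne

/-- **THE UNCUT FREE BLOCK INHABITS THE JUNCTION**: with NO cut-off (`K = univ`), the coupling-free Gaussian density
`e^{Φ} = e^{−quadForm A}` and purely quadratic action (`P = 0`), every hypothesis of
`formAct_couplingTwoPoint_of_insertion_of_nonneg` is discharged (`absAct ≤ 1` uniformly in `r > 0` by
`absAct_le_of_norm_le`, the density having modulus `≤ 1`), so for all `0 < θ < 1`, `γ > 0`, `s, s′ ∈ ]0, γ]` the scaled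
form obeys the coupling two-point clause in t-currency with `N = 1`. [folklore] -/
theorem uncut_formAct_couplingTwoPoint (A : Matrix ι ι ℝ) (hA : A.PosDef) {θ : ℝ} (hθ : 0 < θ) (hθ1 : θ < 1)
    {γ : ℝ} (hγ : 0 < γ) {s s' : ℝ} (hs : s ∈ Ioc 0 γ) (hs' : s' ∈ Ioc 0 γ) :
    ‖formAct (gaussRef A) (scaledCut (Set.univ : Set (ι → ℝ))) (fun _ => 1)
        (scaledExp (fun x : ι → ℝ => -(quadForm A x : ℂ)) (fun _ => (0 : ℝ))) s‖ ≤ 1 ∧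
      ‖formAct (gaussRef A) (scaledCut (Set.univ : Set (ι → ℝ))) (fun _ => 1)
            (scaledExp (fun x : ι → ℝ => -(quadForm A x : ℂ)) (fun _ => (0 : ℝ))) s -
          formAct (gaussRef A) (scaledCut (Set.univ : Set (ι → ℝ))) (fun _ => 1)
            (scaledExp (fun x : ι → ℝ => -(quadForm A x : ℂ)) (fun _ => (0 : ℝ))) s'‖ ≤
        birthConst θ (Fintype.card ι) / (γ⁻¹) ^ 2 * 1 * |(s⁻¹) ^ 2 - (s'⁻¹) ^ 2| := by
  have habs : ∀ r, (1 - θ) * (γ⁻¹) ^ 2 ≤ r →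
      absAct A volume ((Set.univ : Set (ι → ℝ)).indicator fun x => cexp (-(quadForm A x : ℂ)))
        (fun x => quadForm A x + (fun _ : ι → ℝ => (0 : ℝ)) x) r ≤ 1 := by
    intro r hr
    have hr0 : 0 < r := lt_of_lt_of_le (mul_pos (by linarith) (by positivity)) hr
    refine absAct_le_of_norm_le A hA (c := 1) (fun x => ?_) hr0
    rw [Set.indicator_univ, Complex.norm_exp]
    simp only [Complex.neg_re, Complex.ofReal_re]
    exact Real.exp_le_one_iff.2 (neg_nonpos.2 (quadForm_nonneg' A hA x))
  exact formAct_couplingTwoPoint_of_insertion_of_nonneg A hA MeasurableSet.univ (integrable_cexp_neg_quadForm A hA)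
    (P := fun _ => (0 : ℝ)) measurable_const (fun x _ => by rw [add_zero]; exact quadForm_nonneg' A hA x)
    hθ hθ1 hγ habs hs hs'

omit [DecidableEq ι] in
/-- **THE DELETED BINDER IS VOID ON THE UNCUT BLOCK**: for `A ≻ 0` and a non-empty index type the quadratic action is
unbounded on `univ` — no `S₀` with `|quadForm A x + 0| ≤ S₀` for all `x` exists (along the ray `t•𝟙`,
`quadForm A (t•𝟙) = t²·quadForm A 𝟙` with `quadForm A 𝟙 > 0`), so `NE9ScalingDictionary.formAct_couplingTwoPoint_of_insertion`
has no instance there while §5's `uncut_formAct_couplingTwoPoint` concludes. [folklore] -/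
theorem not_bounded_quadForm [Nonempty ι] (A : Matrix ι ι ℝ) (hA : A.PosDef) :
    ¬ ∃ S₀ : ℝ, ∀ x ∈ (Set.univ : Set (ι → ℝ)), |quadForm A x + 0| ≤ S₀ := by
  rintro ⟨S₀, hS₀⟩
  set v : ι → ℝ := fun _ => 1 with hv
  have hv0 : v ≠ 0 := by
    intro h
    have := congr_fun h (Classical.arbitrary ι)
    simp [hv] at this
  have hq : 0 < quadForm A v := by
    rw [quadForm]
    have h := hA.re_dotProduct_pos (x := v) hv0
    simp only [star_trivial, RCLike.re_to_real] at h
    positivity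
  set t : ℝ := (|S₀| + 1) / quadForm A v + 1 with ht
  have ht1 : 1 ≤ t := by
    have : 0 ≤ (|S₀| + 1) / quadForm A v := div_nonneg (by positivity) hq.le
    linarith
  have ht2 : (|S₀| + 1) / quadForm A v ≤ t := by linarith
  have hbig : |S₀| + 1 ≤ t ^ 2 * quadForm A v := by
    have h1 : (|S₀| + 1) ≤ t * quadForm A v := by
      rw [div_le_iff₀ hq] at ht2
      exact ht2
    have h2 : t * quadForm A v ≤ t ^ 2 * quadForm A v := by
      have : t ≤ t ^ 2 := by nlinarith
      exact mul_le_mul_of_nonneg_right this hq.le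
    exact h1.trans h2
  have h := hS₀ (t • v) (Set.mem_univ _)
  rw [add_zero, quadForm_smul, abs_of_nonneg (mul_nonneg (sq_nonneg _) hq.le)] at h
  have hS : S₀ ≤ |S₀| := le_abs_self _
  linarith

end Summit.QuantumFields.BalabanUV.T4Continuum.NE9ScalingDictionaryUnbounded

end
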